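import Summits.QuantumFields.BalabanUV.Beta.GAN24.DressedOrderZeroChain

/-!
# `BalabanUV.Beta.GAN24.DressedOrderZeroChainRate` — binder row G-an2-4 ∕ (CONV-C), route R7 «TWO CURRENCIES»: the dressed V3-type chains of
# `DressedOrderZeroChain` with the background's CONSISTENCY letter at an ARBITRARY rate sequence `δ k` (instead of `βc∕n_k`) — the currency
# in which road P2's sup one-step laws come (`SoftMinimiserOneStepSup`: `(R−1)∕(RN) × (sup letters)`, sup-LOG on cubic tori)

NOT IN PRINT; OUR PROOF ATTEMPT (prover part P3 of row G-an2-4, fibre∕strip («Woodbury») lineage, gen 26; CRUX TEAM (2), ruling «YM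
REDIRECT TOWARDS THE SUMMIT», 2026-08-21).  HONEST DEPENDENCY (cell records, verbatim): «continuum YM on T⁴ ⇐ BetaPertH ∧ nine spine
estimates (0/9 proved); BetaPertH ⇐ (D1) ∧ (D4) ∧ CAP+tail; G-an2-4 gates asym, D1 and NE2/3/4.»  HONEST FRAMING (cell contract, verbatim):
«discharging `BetaPertH` makes Bałaban's UV stability UNCONDITIONAL — a real constructive-QFT result; it is NOT the continuum limit and NOT
the Clay problem.»  ABSOLUTE RULE: nothing printed is a hypothesis; no `def … : Prop`, no sorry; [folklore] algebra over TREE objects BY NAME.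

## What is proved (same proofs as `DressedOrderZeroChain`, consistency letter `‖W (k+1) x′ − W k (parT x′)‖ ≤ δ k`, `δ ≥ 0` arbitrary)

 * `opNorm_faceK_dressed_sub_le_rate : ‖K_μᴴ·T_{k+1}·K_{μ′} − T_k‖ ≤ α²·CK·L^{−k} + 2α·L²·Cst·δ k`;
 * GENERIC `norm_dressedLegChain_sub_le_rate` (legs `αℓ, ε, βℓ`): `≤ 2αℓ(α+β)²Cst·ε + βℓ²·(α²CK·L^{−k} + 2αL²Cst·δ k)`;
 * `norm_softDressedChain_succ_sub_le_rate` (M̃ legs), `norm_hardDressedChain_succ_sub_le_rate` (M̂ legs).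
So a consistency letter in ANY summable∕geometric currency `δ k` (e.g. `C(1 + k·log L)·L^{−k}` from sup-log laws) yields the chain's
Cauchy property at rate `max(L^{−k}, δ k)`.  For h = the physical soft column: size and Lipschitz letters are TREE
(`SoftColumnSupLetter` p263836, `SoftColumnGradSupLetter`); `δ k` = (R7-HCONS), road P2's vector programme.

HONEST SCOPE.  MODEL chains, backgrounds DATA, letters explicit; `U = 1`; NOT (CONV-C), NEVER «G-an2-4 closed», NOT NE2, NOT D1, NOT BetaPertH,
NOT continuum, NOT Clay.  Provenance: prover-b2b-balaban-gan24-p3-g26-0 (unit `b2b-balaban-gan24-p3`, gen 26), 2026-08-21.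
-/

noncomputable section

open scoped BigOperators ComplexConjugate Matrix Matrix.Norms.L2Operator
open Finset

namespace Summit.QuantumFields.BalabanUV.Beta.GAN24.DressedOrderZeroChainRate

open Literature.MathematicalPhysics.QuantumFieldTheory.Balaban1983to89.B5Prop11Plancherel
open Literature.MathematicalPhysics.QuantumFieldTheory.Balaban1983to89.B5G183RateUnitTower (lev lev_neZero)
open Summit.QuantumFields.BalabanUV.T4Continuum
open Summit.QuantumFields.BalabanUV.T4Continuum.BalabanAveragedTowerUnit (idx lev_succ' one_le_lev' cast_lev' calGlev)
open Summit.QuantumFields.BalabanUV.T4Continuum.BalabanMinimizerLaw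
open Summit.QuantumFields.BalabanUV.T4Continuum.BlockPairingGeometry (parT)
open Summit.QuantumFields.BalabanUV.T4Continuum.KingLaplacianConsistency (gradC gradF)
open Summit.QuantumFields.BalabanUV.T4Continuum.BalabanAveragedCoercive (gammaB gammaB_pos)
open Summit.QuantumFields.BalabanUV.Beta.GAN24.SoftColumnVertexRate (opNorm_Mtil_le)
open Summit.QuantumFields.BalabanUV.Beta.GAN24.SoftColumnCovarianceChain (norm_conjTranspose_mul_mul_apply_le)
open Summit.QuantumFields.BalabanUV.Beta.GAN24.OrderZeroSlotLaw (faceK CK CK_nonneg)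
open Summit.QuantumFields.BalabanUV.Beta.GAN24.SoftColumnOrderZeroChain (opNorm_grad_Mtil_le legChain_sub_eq)
open Summit.QuantumFields.BalabanUV.Beta.GAN24.HardColumnChains (Mhat CHH CHH_nonneg opNorm_Mhat_le opNorm_grad_Mhat_le opNorm_Mhat_succ_sub_le)
open Summit.QuantumFields.BalabanUV.Beta.GAN24.DressedOrderZeroSlotLaw
open Summit.QuantumFields.BalabanUV.Beta.GAN24.DressedOrderZeroChain

variable {d : ℕ} (L : ℕ) [NeZero L] (M : Fin d → ℕ) [hM : ∀ μ, NeZero (M μ)] (a : ℝ) (ha : 0 < a)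

/-- **THE DRESSED FACE-PLANTED LAW ALONG THE TOWER, CONSISTENCY AT RATE `δ k`** (`d ≥ 1`):
`‖K_μᴴ·T_{k+1}·K_{μ′} − T_k‖ ≤ α²·CK·L^{−k} + 2α·L²·Cst·δ k`. [folklore] -/
theorem opNorm_faceK_dressed_sub_le_rate (hd : 1 ≤ d) (W₁ W₂ : (k : ℕ) → (idx L M k → ℂ)) {α : ℝ} {δ : ℕ → ℝ} (hα : 0 ≤ α)
    (hδ : ∀ k, 0 ≤ δ k) (hW₁ : ∀ k i, ‖W₁ k i‖ ≤ α) (hW₂ : ∀ k i, ‖W₂ k i‖ ≤ α)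
    (hc₁ : ∀ k (i : idx L M (k + 1)), ‖W₁ (k + 1) i - W₁ k (parT (lev L k) L M i)‖ ≤ δ k)
    (hc₂ : ∀ k (i : idx L M (k + 1)), ‖W₂ (k + 1) i - W₂ k (parT (lev L k) L M i)‖ ≤ δ k) (k : ℕ) (μ μ' : Fin d) :
    ‖(faceK (lev L k) L M μ)ᴴ * Tmidsucc L M a ha W₁ W₂ k * faceK (lev L k) L M μ' - Tmid L M a ha W₁ W₂ k‖
      ≤ α * α * CK d L a * ((L : ℝ)⁻¹) ^ k + 2 * α * ((L : ℝ) * L) * Cst d a * δ k := by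
  have hL1 : 1 ≤ L := Nat.pos_of_ne_zero (NeZero.ne L)
  have h := opNorm_faceK_dressed_sub_le' (lev L k) L M a ha hd (one_le_lev' L k) hL1 (one_le_lev' L (k + 1)) μ μ' hα (hδ k)
    (hW₁ k) (hW₂ k) (hW₂ (k + 1)) (hc₁ k) (hc₂ k)
  rw [Tmidsucc, Tmid, calGlev]
  refine h.trans (le_of_eq ?_)
  rw [cast_lev', div_eq_mul_inv, ← inv_pow]

section Generic

variable {κ κ' : Type*} [Fintype κ] [DecidableEq κ] [Fintype κ'] [DecidableEq κ']

/-- **THE DRESSED-SLOT CHAIN BETWEEN GENERIC LEGS, CONSISTENCY AT RATE `δ k`** (`d ≥ 1`):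
`≤ 2·αℓ·(α+β)²Cst·ε + βℓ·(α²CK·L^{−k} + 2αL²Cst·δ k)·βℓ`. [folklore] -/
theorem norm_dressedLegChain_sub_le_rate (hd : 1 ≤ d) (W₁ W₂ : (k : ℕ) → (idx L M k → ℂ)) {α β : ℝ} {δ : ℕ → ℝ} (hα : 0 ≤ α)
    (hβ : 0 ≤ β) (hδ : ∀ k, 0 ≤ δ k) (hW₁ : ∀ k i, ‖W₁ k i‖ ≤ α) (hW₂ : ∀ k i, ‖W₂ k i‖ ≤ α)
    (hL₁ : ∀ k (μ : Fin d) i, ‖W₁ k i - shiftBack (lev L k) M μ (W₁ k) i‖ ≤ β / (lev L k : ℕ))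
    (hL₂ : ∀ k (μ : Fin d) i, ‖W₂ k i - shiftBack (lev L k) M μ (W₂ k) i‖ ≤ β / (lev L k : ℕ))
    (hc₁ : ∀ k (i : idx L M (k + 1)), ‖W₁ (k + 1) i - W₁ k (parT (lev L k) L M i)‖ ≤ δ k)
    (hc₂ : ∀ k (i : idx L M (k + 1)), ‖W₂ (k + 1) i - W₂ k (parT (lev L k) L M i)‖ ≤ δ k)
    (k : ℕ) (μ μ' : Fin d)
    (X₁ : Matrix (Tor (fine (L * lev L k) M) × Fin d) κ ℂ) (Y₁ : Matrix (Tor (fine (L * lev L k) M) × Fin d) κ' ℂ)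
    (X₀ : Matrix (idx L M k) κ ℂ) (Y₀ : Matrix (idx L M k) κ' ℂ) {αℓ ε βℓ : ℝ} (hαℓ : 0 ≤ αℓ) (hε : 0 ≤ ε) (hβℓ : 0 ≤ βℓ)
    (hX₁ : ‖X₁‖ ≤ αℓ) (hY₀ : ‖Y₀‖ ≤ αℓ) (hXr : ‖X₁ - Jpc L M k * X₀‖ ≤ ε) (hYr : ‖Y₁ - Jpc L M k * Y₀‖ ≤ ε)
    (hXg : ‖gradC (lev L k) M μ * X₀‖ ≤ βℓ) (hYg : ‖gradC (lev L k) M μ' * Y₀‖ ≤ βℓ) (p : κ) (r : κ') :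
    ‖(X₁ᴴ * DRopsucc L M a ha W₁ W₂ k μ μ' * Y₁ - X₀ᴴ * DRop L M a ha W₁ W₂ k μ μ' * Y₀) p r‖
      ≤ 2 * (αℓ * ((α + β) * ((α + β) * Cst d a)) * ε)
        + βℓ * (α * α * CK d L a * ((L : ℝ)⁻¹) ^ k + 2 * α * ((L : ℝ) * L) * Cst d a * δ k) * βℓ := by
  have hR' := opNorm_DRopsucc_le L M a ha W₁ W₂ hα hβ hW₁ hW₂ hL₁ hL₂ k μ μ'
  have hS := opNorm_faceK_dressed_sub_le_rate L M a ha hd W₁ W₂ hα hδ hW₁ hW₂ hc₁ hc₂ k μ μ'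
  have hCst := Cst_nonneg d a
  have hρ : 0 ≤ (α + β) * ((α + β) * Cst d a) := by positivity
  have hσ : 0 ≤ α * α * CK d L a * ((L : ℝ)⁻¹) ^ k + 2 * α * ((L : ℝ) * L) * Cst d a * δ k := (norm_nonneg _).trans hS
  have hJY : ‖Jpc L M k * Y₀‖ ≤ αℓ :=
    (Matrix.l2_opNorm_mul _ _).trans ((mul_le_mul (opNorm_Jpc_le L M k) hY₀ (norm_nonneg _) zero_le_one).trans (le_of_eq (one_mul _)))
  have h3 : X₀ᴴ * ((Jpc L M k)ᴴ * DRopsucc L M a ha W₁ W₂ k μ μ' * Jpc L M k - DRop L M a ha W₁ W₂ k μ μ') * Y₀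
      = (gradC (lev L k) M μ * X₀)ᴴ
          * ((faceK (lev L k) L M μ)ᴴ * Tmidsucc L M a ha W₁ W₂ k * faceK (lev L k) L M μ' - Tmid L M a ha W₁ W₂ k)
          * (gradC (lev L k) M μ' * Y₀) := by
    rw [sandwich_dressed_sub_eq_lev, Matrix.conjTranspose_mul]
    simp only [Matrix.mul_assoc]
  rw [legChain_sub_eq X₁ Y₁ X₀ Y₀ (DRopsucc L M a ha W₁ W₂ k μ μ') (DRop L M a ha W₁ W₂ k μ μ') (Jpc L M k), Matrix.add_apply,
    Matrix.add_apply, h3]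
  have t1 : ‖(X₁ᴴ * DRopsucc L M a ha W₁ W₂ k μ μ' * (Y₁ - Jpc L M k * Y₀)) p r‖ ≤ αℓ * ((α + β) * ((α + β) * Cst d a)) * ε :=
    (norm_conjTranspose_mul_mul_apply_le _ _ _ p r).trans
      (mul_le_mul (mul_le_mul hX₁ hR' (norm_nonneg _) hαℓ) hYr (norm_nonneg _) (mul_nonneg hαℓ hρ))
  have t2 : ‖((X₁ - Jpc L M k * X₀)ᴴ * DRopsucc L M a ha W₁ W₂ k μ μ' * (Jpc L M k * Y₀)) p r‖ ≤ ε * ((α + β) * ((α + β) * Cst d a)) * αℓ :=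
    (norm_conjTranspose_mul_mul_apply_le _ _ _ p r).trans
      (mul_le_mul (mul_le_mul hXr hR' (norm_nonneg _) hε) hJY (norm_nonneg _) (mul_nonneg hε hρ))
  have t3 : ‖((gradC (lev L k) M μ * X₀)ᴴ
      * ((faceK (lev L k) L M μ)ᴴ * Tmidsucc L M a ha W₁ W₂ k * faceK (lev L k) L M μ' - Tmid L M a ha W₁ W₂ k)
      * (gradC (lev L k) M μ' * Y₀)) p r‖
        ≤ βℓ * (α * α * CK d L a * ((L : ℝ)⁻¹) ^ k + 2 * α * ((L : ℝ) * L) * Cst d a * δ k) * βℓ :=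
    (norm_conjTranspose_mul_mul_apply_le _ _ _ p r).trans
      (mul_le_mul (mul_le_mul hXg hS (norm_nonneg _) hβℓ) hYg (norm_nonneg _) (mul_nonneg hβℓ hσ))
  calc _ ≤ ‖(X₁ᴴ * DRopsucc L M a ha W₁ W₂ k μ μ' * (Y₁ - Jpc L M k * Y₀)) p r
            + ((X₁ - Jpc L M k * X₀)ᴴ * DRopsucc L M a ha W₁ W₂ k μ μ' * (Jpc L M k * Y₀)) p r‖
          + ‖((gradC (lev L k) M μ * X₀)ᴴ
            * ((faceK (lev L k) L M μ)ᴴ * Tmidsucc L M a ha W₁ W₂ k * faceK (lev L k) L M μ' - Tmid L M a ha W₁ W₂ k)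
            * (gradC (lev L k) M μ' * Y₀)) p r‖ := norm_add_le _ _
    _ ≤ (αℓ * ((α + β) * ((α + β) * Cst d a)) * ε + ε * ((α + β) * ((α + β) * Cst d a)) * αℓ)
          + βℓ * (α * α * CK d L a * ((L : ℝ)⁻¹) ^ k + 2 * α * ((L : ℝ) * L) * Cst d a * δ k) * βℓ :=
        add_le_add ((norm_add_le _ _).trans (add_le_add t1 t2)) t3
    _ = _ := by ring

end Generic

/-- **THE SOFT-LEG V3-TYPE CHAIN, CONSISTENCY AT RATE `δ k`**: entrywise
`≤ 2(aCst)(α+β)²Cst·(aCQH)·L^{−k} + (aCst)²·(α²CK·L^{−k} + 2αL²Cst·δ k)`. [folklore] -/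
theorem norm_softDressedChain_succ_sub_le_rate (hd : 1 ≤ d) (W₁ W₂ : (k : ℕ) → (idx L M k → ℂ)) {α β : ℝ} {δ : ℕ → ℝ}
    (hα : 0 ≤ α) (hβ : 0 ≤ β) (hδ : ∀ k, 0 ≤ δ k) (hW₁ : ∀ k i, ‖W₁ k i‖ ≤ α) (hW₂ : ∀ k i, ‖W₂ k i‖ ≤ α)
    (hL₁ : ∀ k (μ : Fin d) i, ‖W₁ k i - shiftBack (lev L k) M μ (W₁ k) i‖ ≤ β / (lev L k : ℕ))
    (hL₂ : ∀ k (μ : Fin d) i, ‖W₂ k i - shiftBack (lev L k) M μ (W₂ k) i‖ ≤ β / (lev L k : ℕ))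
    (hc₁ : ∀ k (i : idx L M (k + 1)), ‖W₁ (k + 1) i - W₁ k (parT (lev L k) L M i)‖ ≤ δ k)
    (hc₂ : ∀ k (i : idx L M (k + 1)), ‖W₂ (k + 1) i - W₂ k (parT (lev L k) L M i)‖ ≤ δ k)
    (k : ℕ) (μ μ' : Fin d) (p r : idx L M 0) :
    ‖((atSucc' L M k (Mtil L M a ha (k + 1)))ᴴ * DRopsucc L M a ha W₁ W₂ k μ μ' * atSucc' L M k (Mtil L M a ha (k + 1))
        - (Mtil L M a ha k)ᴴ * DRop L M a ha W₁ W₂ k μ μ' * Mtil L M a ha k) p r‖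
      ≤ 2 * ((a * Cst d a) * ((α + β) * ((α + β) * Cst d a)) * (a * CQH d a * ((L : ℝ)⁻¹) ^ k))
          + (a * Cst d a) * (α * α * CK d L a * ((L : ℝ)⁻¹) ^ k + 2 * α * ((L : ℝ) * L) * Cst d a * δ k) * (a * Cst d a) := by
  have hA : ‖Mtil L M a ha k‖ ≤ a * Cst d a := opNorm_Mtil_le L M a ha k
  have hD : ‖atSucc' L M k (Mtil L M a ha (k + 1)) - Jpc L M k * Mtil L M a ha k‖ ≤ a * CQH d a * ((L : ℝ)⁻¹) ^ k :=
    opNorm_Mtil_succ_sub_le L M a ha k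
  exact norm_dressedLegChain_sub_le_rate L M a ha hd W₁ W₂ hα hβ hδ hW₁ hW₂ hL₁ hL₂ hc₁ hc₂ k μ μ'
    (atSucc' L M k (Mtil L M a ha (k + 1))) (atSucc' L M k (Mtil L M a ha (k + 1))) (Mtil L M a ha k) (Mtil L M a ha k)
    (mul_nonneg ha.le (Cst_nonneg d a)) ((norm_nonneg _).trans hD) (mul_nonneg ha.le (Cst_nonneg d a))
    (opNorm_Mtil_le L M a ha (k + 1)) hA hD hD (opNorm_grad_Mtil_le L M a ha k μ) (opNorm_grad_Mtil_le L M a ha k μ') p r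

/-- **THE HARD-LEG V3-TYPE CHAIN, CONSISTENCY AT RATE `δ k`**: entrywise
`≤ 2(Cst∕γ)(α+β)²Cst·CHH·L^{−k} + (Cst∕γ)²·(α²CK·L^{−k} + 2αL²Cst·δ k)`. [folklore] -/
theorem norm_hardDressedChain_succ_sub_le_rate (hd : 1 ≤ d) (W₁ W₂ : (k : ℕ) → (idx L M k → ℂ)) {α β : ℝ} {δ : ℕ → ℝ}
    (hα : 0 ≤ α) (hβ : 0 ≤ β) (hδ : ∀ k, 0 ≤ δ k) (hW₁ : ∀ k i, ‖W₁ k i‖ ≤ α) (hW₂ : ∀ k i, ‖W₂ k i‖ ≤ α)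
    (hL₁ : ∀ k (μ : Fin d) i, ‖W₁ k i - shiftBack (lev L k) M μ (W₁ k) i‖ ≤ β / (lev L k : ℕ))
    (hL₂ : ∀ k (μ : Fin d) i, ‖W₂ k i - shiftBack (lev L k) M μ (W₂ k) i‖ ≤ β / (lev L k : ℕ))
    (hc₁ : ∀ k (i : idx L M (k + 1)), ‖W₁ (k + 1) i - W₁ k (parT (lev L k) L M i)‖ ≤ δ k)
    (hc₂ : ∀ k (i : idx L M (k + 1)), ‖W₂ (k + 1) i - W₂ k (parT (lev L k) L M i)‖ ≤ δ k)
    (k : ℕ) (μ μ' : Fin d) (p r : idx L M 0) :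
    ‖((atSucc' L M k (Mhat L M a ha (k + 1)))ᴴ * DRopsucc L M a ha W₁ W₂ k μ μ' * atSucc' L M k (Mhat L M a ha (k + 1))
        - (Mhat L M a ha k)ᴴ * DRop L M a ha W₁ W₂ k μ μ' * Mhat L M a ha k) p r‖
      ≤ 2 * ((Cst d a * (gammaB d a)⁻¹) * ((α + β) * ((α + β) * Cst d a)) * (CHH d a * ((L : ℝ)⁻¹) ^ k))
          + (Cst d a * (gammaB d a)⁻¹) * (α * α * CK d L a * ((L : ℝ)⁻¹) ^ k + 2 * α * ((L : ℝ) * L) * Cst d a * δ k)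
            * (Cst d a * (gammaB d a)⁻¹) := by
  have hαℓ : 0 ≤ Cst d a * (gammaB d a)⁻¹ := mul_nonneg (Cst_nonneg d a) (inv_nonneg.mpr (gammaB_pos (d := d) a ha).le)
  have hD := opNorm_Mhat_succ_sub_le L M a ha k
  exact norm_dressedLegChain_sub_le_rate L M a ha hd W₁ W₂ hα hβ hδ hW₁ hW₂ hL₁ hL₂ hc₁ hc₂ k μ μ'
    (atSucc' L M k (Mhat L M a ha (k + 1))) (atSucc' L M k (Mhat L M a ha (k + 1))) (Mhat L M a ha k) (Mhat L M a ha k)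
    hαℓ ((norm_nonneg _).trans hD) hαℓ (opNorm_Mhat_le L M a ha (k + 1)) (opNorm_Mhat_le L M a ha k) hD hD
    (opNorm_grad_Mhat_le L M a ha k μ) (opNorm_grad_Mhat_le L M a ha k μ') p r

end Summit.QuantumFields.BalabanUV.Beta.GAN24.DressedOrderZeroChainRate

end
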